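/- Width seat `ym-line-sfw-p2-w5` (prover-ym-line-sfw-p2-w5-g18-0), free hands on planner ym-idea-2 g16's LINE-19 task board (STUB-PLAN-S4b §11):
the discrete Caccioppoli inequality for the Hodge column at radii `r ≥ 3`, and the §11 energy decay (hence H4b.1) from S3 alone. -/
import Summits.QuantumFields.YangMills.Theorems.AllWindowsColdBoxBoxHighLineCaccioppoliCutoff
import Summits.QuantumFields.YangMills.Theorems.AllWindowsColdBoxBoxHighLineEnergyDecayAssembly
import Summits.QuantumFields.YangMills.Theorems.AllWindowsColdBoxBoxHighLineLayerCake

/-!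
# LINE-19 S4b §11: the discrete Caccioppoli inequality for `hodgeQ` (radii `r ≥ 3`) and `H4b1one ⇐ S3`

With the toolkit ✓`hodge_caccioppoli_identity`, ✓`abs_commutator_sum_le`, ✓`…HodgeSupports`, ✓`…CaccioppoliCutoff`, this file proves the
Caccioppoli inequality of STUB-PLAN-S4b §11 for every radius `r ≥ 3` — **`hodgeCaccioppoli_three`**:
`Σ_{p : d(e,p) ≥ 2r} ((hodgeQ⁻¹λ_p)_e)² ≤ 4896·r⁻²·Σ_{r ≤ ℓ¹(e,e') < 2r+4} ((hodgeQ⁻¹)_{e e'})²`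
(the cut-off column `χu` has the far curl energy below its full curl+gauge energy, which by the identity is `−½`·(commutator sums); each
commutator lives on supports inside the zone `r ≤ ℓ¹ ≤ 2r`, is `≤ (2/(r−2))²·A²·N·(zone mass on the support)`, and every edge is seen by `≤ 16`
plaquette and `≤ 2` site functionals; `(2/(r−2))² ≤ 36/r²`), and then the §11 target from S3 alone —
**`gradKernelEnergyDecay_of_S3 : LandauKernelDecay → LandauVarianceBounded → GradKernelEnergyDecay`** (`j ≤ 5` by the variance bound
✓`sum_sq_gradKernel_le_diag`; `j ≥ 6`: `r = ⌊j/2⌋ ≥ 3`, Caccioppoli + the annulus energy ✓`annulus_sum_sq_le`) and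
**`h4b1one_of_S3 : LandauKernelDecay → LandauVarianceBounded → H4b1one`** (✓`h4b1one_of_energyDecay`).  So the bootstrap input H4b.1 of S4b now
depends on the registered stub S3 `stub_landauKernelBounds` ALONE (the typed `HodgeCaccioppoli` for `r ∈ {1,2}` is no longer needed on this path).

Everything proved; no definition; standard axioms.  HONEST LABEL: helpers toward ONE registered stub (S4b) of a critic-PASSed line on the R2ξ″
RECORD-rung crux 24004 / 24335; S3 and S4b remain OPEN; no stub is proved by name, no crux, rung or summit is proved; the Yang–Mills mass gap is NOT
proved by this file.
-/

set_option autoImplicit false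

noncomputable section

open Finset Matrix
open Literature.MathematicalPhysics.QuantumFieldTheory
open Literature.MathematicalPhysics.QuantumFieldTheory.LatticeMaxwell
open Literature.MathematicalPhysics.QuantumFieldTheory.AxialGauge
open Summit.QuantumFields.YangMills.Theorems.WeakCouplingRates
open Summit.QuantumFields.YangMills.Theorems.AllWindowsColdBox
open Literature.Probability.LatticeModels (Site)

namespace Summit.QuantumFields.YangMills.Theorems.AllWindowsColdBoxBoxHighLine

/-! ## The Caccioppoli inequality at radii `r ≥ 3` -/

/-- The zone `r ≤ d ≤ 2r` lies inside the annulus `r ≤ d < 2r + 4` of `HodgeCaccioppoli`. -/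
theorem zone_sum_le_annulus {H : ℕ} (e : LandauFree H) (r : ℕ) (v : LandauFree H → ℝ) :
    ∑ i, (if (r : ℤ) ≤ edgeDist e i ∧ edgeDist e i ≤ 2 * (r : ℤ) then v i ^ 2 else 0) ≤
      ∑ e' ∈ (Finset.univ : Finset (LandauFree H)).filter
        (fun e' => (r : ℤ) ≤ ∑ m : Fin 4, |e.1.1.1 m - e'.1.1.1 m| ∧ ∑ m : Fin 4, |e.1.1.1 m - e'.1.1.1 m| < 2 * r + 4),
        v e' ^ 2 := by
  rw [← Finset.sum_filter]
  refine Finset.sum_le_sum_of_subset_of_nonneg ?_ fun _ _ _ => sq_nonneg _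
  intro i hi
  rw [Finset.mem_filter] at hi ⊢
  refine ⟨hi.1, ?_⟩
  have h := hi.2
  unfold edgeDist at h
  constructor
  · exact h.1
  · linarith [h.2]

/-- **The discrete Caccioppoli inequality for the Hodge column, radii `r ≥ 3`** (constant `4896`). -/
theorem hodgeCaccioppoli_three {H : ℕ} (e : LandauFree H) {r : ℕ} (hr : 3 ≤ r) :
    ∑ p ∈ (hodgePlaqs H).filter (fun p => 2 * (r : ℤ) ≤ edgePlaqDist e p), (((hodgeQ H)⁻¹ *ᵥ landauCoeff H p) e) ^ 2 ≤
      4896 / (r : ℝ) ^ 2 * ∑ e' ∈ (Finset.univ : Finset (LandauFree H)).filter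
        (fun e' => (r : ℤ) ≤ ∑ m : Fin 4, |e.1.1.1 m - e'.1.1.1 m| ∧ ∑ m : Fin 4, |e.1.1.1 m - e'.1.1.1 m| < 2 * r + 4),
        ((hodgeQ H)⁻¹ e e') ^ 2 := by
  have hr' : (3 : ℝ) ≤ r := by exact_mod_cast hr
  have hw : (0 : ℝ) < (r : ℝ) - 2 := by linarith
  have hr0 : (0 : ℝ) < r := by linarith
  -- (1) on the far plaquettes the cutoff is invisible
  have hfar : ∀ p ∈ (hodgePlaqs H).filter (fun p => 2 * (r : ℤ) ≤ edgePlaqDist e p),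
      ((hodgeQ H)⁻¹ *ᵥ landauCoeff H p) e = ∑ i, landauCoeff H p i * (cutoff e r i * (hodgeQ H)⁻¹ e i) := by
    intro p hp
    have hp2 := (Finset.mem_filter.1 hp).2
    simp only [Matrix.mulVec, dotProduct]
    refine Finset.sum_congr rfl fun i _ => ?_
    by_cases hlam : landauCoeff H p i = 0
    · rw [hlam]; ring
    · have hd := abs_dist_sub_edgePlaqDist_le_one e hlam
      rw [abs_le] at hd
      have h1 : cutoff e r i = 1 := cutoff_eq_one_of_ge e hr (by unfold edgeDist; linarith [hd.1])
      rw [h1]; ring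
  -- (2) the far curl energy is at most the full curl + gauge energy of the cut-off column
  have hE : ∑ p ∈ (hodgePlaqs H).filter (fun p => 2 * (r : ℤ) ≤ edgePlaqDist e p), (((hodgeQ H)⁻¹ *ᵥ landauCoeff H p) e) ^ 2 ≤
      (∑ p ∈ hodgePlaqs H, (∑ i, landauCoeff H p i * (cutoff e r i * (hodgeQ H)⁻¹ e i)) ^ 2) +
        ∑ x ∈ interiorSites H, (∑ i, gradVec H x i * (cutoff e r i * (hodgeQ H)⁻¹ e i)) ^ 2 := by
    calc ∑ p ∈ (hodgePlaqs H).filter (fun p => 2 * (r : ℤ) ≤ edgePlaqDist e p), (((hodgeQ H)⁻¹ *ᵥ landauCoeff H p) e) ^ 2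
        = ∑ p ∈ (hodgePlaqs H).filter (fun p => 2 * (r : ℤ) ≤ edgePlaqDist e p),
            (∑ i, landauCoeff H p i * (cutoff e r i * (hodgeQ H)⁻¹ e i)) ^ 2 :=
          Finset.sum_congr rfl fun p hp => by rw [hfar p hp]
      _ ≤ ∑ p ∈ hodgePlaqs H, (∑ i, landauCoeff H p i * (cutoff e r i * (hodgeQ H)⁻¹ e i)) ^ 2 :=
          Finset.sum_le_sum_of_subset_of_nonneg (Finset.filter_subset _ _) fun _ _ _ => sq_nonneg _
      _ ≤ _ := le_add_of_nonneg_right (Finset.sum_nonneg fun _ _ => sq_nonneg _)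
  -- (3) the Caccioppoli identity and the commutator bounds
  have hid := hodge_caccioppoli_identity e (cutoff e r) (cutoff_self e hr)
  have hcommP : ∀ p ∈ hodgePlaqs H,
      |∑ i, ∑ j, landauCoeff H p i * landauCoeff H p j * ((hodgeQ H)⁻¹ e i * (hodgeQ H)⁻¹ e j) *
        (cutoff e r i - cutoff e r j) ^ 2| ≤
      (2 / ((r : ℝ) - 2)) ^ 2 * 2 ^ 2 * (4 : ℕ) *
        ∑ i ∈ (Finset.univ : Finset (LandauFree H)).filter (fun i => landauCoeff H p i ≠ 0),
          (if (r : ℤ) ≤ edgeDist e i ∧ edgeDist e i ≤ 2 * (r : ℤ) then ((hodgeQ H)⁻¹ e i) ^ 2 else 0) := by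
    intro p _
    refine abs_commutator_cutoff_le_zone e hr (landauCoeff H p) (fun i => (hodgeQ H)⁻¹ e i) (by norm_num)
      (abs_landauCoeff_le_two p) (card_support_landauCoeff_le p) ?_
    intro i j hi hj
    have h := abs_dist_sub_dist_le_two_of_landauCoeff e hi hj
    unfold edgeDist
    exact_mod_cast h
  have hcommX : ∀ x ∈ interiorSites H,
      |∑ i, ∑ j, gradVec H x i * gradVec H x j * ((hodgeQ H)⁻¹ e i * (hodgeQ H)⁻¹ e j) *
        (cutoff e r i - cutoff e r j) ^ 2| ≤
      (2 / ((r : ℝ) - 2)) ^ 2 * 1 ^ 2 * (8 : ℕ) *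
        ∑ i ∈ (Finset.univ : Finset (LandauFree H)).filter (fun i => gradVec H x i ≠ 0),
          (if (r : ℤ) ≤ edgeDist e i ∧ edgeDist e i ≤ 2 * (r : ℤ) then ((hodgeQ H)⁻¹ e i) ^ 2 else 0) := by
    intro x _
    refine abs_commutator_cutoff_le_zone e hr (gradVec H x) (fun i => (hodgeQ H)⁻¹ e i) (by norm_num)
      (abs_gradVec_le_one x) (card_support_gradVec_le x) ?_
    intro i j hi hj
    have h := abs_dist_sub_dist_le_two_of_gradVec e hi hj
    unfold edgeDist
    exact_mod_cast h
  -- (4) multiplicities: every edge is seen by ≤ 16 plaquette functionals and ≤ 2 site functionals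
  have hf0 : ∀ i : LandauFree H, 0 ≤ (if (r : ℤ) ≤ edgeDist e i ∧ edgeDist e i ≤ 2 * (r : ℤ) then ((hodgeQ H)⁻¹ e i) ^ 2 else 0) :=
    fun i => by split_ifs <;> positivity
  have hmultP := sum_sum_support_le_mul (hodgePlaqs H) (fun p => landauCoeff H p)
    (fun i => if (r : ℤ) ≤ edgeDist e i ∧ edgeDist e i ≤ 2 * (r : ℤ) then ((hodgeQ H)⁻¹ e i) ^ 2 else 0) hf0
    (M := 16) (fun i => card_filter_landauCoeff_ne_zero_le (hodgePlaqs H) i)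
  have hmultX := sum_sum_support_le_mul (interiorSites H) (fun x => gradVec H x)
    (fun i => if (r : ℤ) ≤ edgeDist e i ∧ edgeDist e i ≤ 2 * (r : ℤ) then ((hodgeQ H)⁻¹ e i) ^ 2 else 0) hf0
    (M := 2) (fun i => card_filter_gradVec_ne_zero_le (interiorSites H) i)
  have hzone := zone_sum_le_annulus e r (fun i => (hodgeQ H)⁻¹ e i)
  -- (5) assemble
  have hT0 : 0 ≤ ∑ i, (if (r : ℤ) ≤ edgeDist e i ∧ edgeDist e i ≤ 2 * (r : ℤ) then ((hodgeQ H)⁻¹ e i) ^ 2 else 0) :=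
    Finset.sum_nonneg fun i _ => hf0 i
  have hκ : (2 / ((r : ℝ) - 2)) ^ 2 ≤ 36 / (r : ℝ) ^ 2 := by
    rw [div_pow, div_le_div_iff₀ (pow_pos hw 2) (pow_pos hr0 2)]
    have h3 : 0 ≤ ((r : ℝ) - 3) * (32 * (r : ℝ) - 48) := mul_nonneg (by linarith) (by linarith)
    nlinarith [h3]
  have hκ0 : 0 ≤ (2 / ((r : ℝ) - 2)) ^ 2 := sq_nonneg _
  have hsumP : ∑ p ∈ hodgePlaqs H, |∑ i, ∑ j, landauCoeff H p i * landauCoeff H p j *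
      ((hodgeQ H)⁻¹ e i * (hodgeQ H)⁻¹ e j) * (cutoff e r i - cutoff e r j) ^ 2| ≤
      (2 / ((r : ℝ) - 2)) ^ 2 * 16 * (16 * ∑ i, (if (r : ℤ) ≤ edgeDist e i ∧ edgeDist e i ≤ 2 * (r : ℤ) then
        ((hodgeQ H)⁻¹ e i) ^ 2 else 0)) := by
    refine (Finset.sum_le_sum hcommP).trans ?_
    rw [← Finset.mul_sum]
    have h16 : (2 / ((r : ℝ) - 2)) ^ 2 * 2 ^ 2 * ((4 : ℕ) : ℝ) = (2 / ((r : ℝ) - 2)) ^ 2 * 16 := by norm_num; ring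
    rw [h16]
    refine mul_le_mul_of_nonneg_left ?_ (mul_nonneg hκ0 (by norm_num))
    exact_mod_cast hmultP
  have hsumX : ∑ x ∈ interiorSites H, |∑ i, ∑ j, gradVec H x i * gradVec H x j *
      ((hodgeQ H)⁻¹ e i * (hodgeQ H)⁻¹ e j) * (cutoff e r i - cutoff e r j) ^ 2| ≤
      (2 / ((r : ℝ) - 2)) ^ 2 * 8 * (2 * ∑ i, (if (r : ℤ) ≤ edgeDist e i ∧ edgeDist e i ≤ 2 * (r : ℤ) then
        ((hodgeQ H)⁻¹ e i) ^ 2 else 0)) := by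
    refine (Finset.sum_le_sum hcommX).trans ?_
    rw [← Finset.mul_sum]
    have h8 : (2 / ((r : ℝ) - 2)) ^ 2 * 1 ^ 2 * ((8 : ℕ) : ℝ) = (2 / ((r : ℝ) - 2)) ^ 2 * 8 := by norm_num
    rw [h8]
    refine mul_le_mul_of_nonneg_left ?_ (mul_nonneg hκ0 (by norm_num))
    exact_mod_cast hmultX
  have habsP := Finset.abs_sum_le_sum_abs (s := hodgePlaqs H) (f := fun p => ∑ i, ∑ j, landauCoeff H p i * landauCoeff H p j *
      ((hodgeQ H)⁻¹ e i * (hodgeQ H)⁻¹ e j) * (cutoff e r i - cutoff e r j) ^ 2)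
  have habsX := Finset.abs_sum_le_sum_abs (s := interiorSites H) (f := fun x => ∑ i, ∑ j, gradVec H x i * gradVec H x j *
      ((hodgeQ H)⁻¹ e i * (hodgeQ H)⁻¹ e j) * (cutoff e r i - cutoff e r j) ^ 2)
  have hnegP := neg_abs_le (∑ p ∈ hodgePlaqs H, ∑ i, ∑ j, landauCoeff H p i * landauCoeff H p j *
      ((hodgeQ H)⁻¹ e i * (hodgeQ H)⁻¹ e j) * (cutoff e r i - cutoff e r j) ^ 2)
  have hnegX := neg_abs_le (∑ x ∈ interiorSites H, ∑ i, ∑ j, gradVec H x i * gradVec H x j *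
      ((hodgeQ H)⁻¹ e i * (hodgeQ H)⁻¹ e j) * (cutoff e r i - cutoff e r j) ^ 2)
  have hann0 : 0 ≤ ∑ e' ∈ (Finset.univ : Finset (LandauFree H)).filter
      (fun e' => (r : ℤ) ≤ ∑ m : Fin 4, |e.1.1.1 m - e'.1.1.1 m| ∧ ∑ m : Fin 4, |e.1.1.1 m - e'.1.1.1 m| < 2 * r + 4),
      ((hodgeQ H)⁻¹ e e') ^ 2 := Finset.sum_nonneg fun _ _ => sq_nonneg _
  -- the chain
  refine hE.trans ?_
  rw [hid]
  have key : -(1 / 2 : ℝ) * ((∑ p ∈ hodgePlaqs H, ∑ i, ∑ j, landauCoeff H p i * landauCoeff H p j *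
        ((hodgeQ H)⁻¹ e i * (hodgeQ H)⁻¹ e j) * (cutoff e r i - cutoff e r j) ^ 2) +
      ∑ x ∈ interiorSites H, ∑ i, ∑ j, gradVec H x i * gradVec H x j *
        ((hodgeQ H)⁻¹ e i * (hodgeQ H)⁻¹ e j) * (cutoff e r i - cutoff e r j) ^ 2) ≤
      136 * (2 / ((r : ℝ) - 2)) ^ 2 *
        ∑ i, (if (r : ℤ) ≤ edgeDist e i ∧ edgeDist e i ≤ 2 * (r : ℤ) then ((hodgeQ H)⁻¹ e i) ^ 2 else 0) := by
    nlinarith [hsumP, hsumX, habsP, habsX, hnegP, hnegX, hT0, hκ0]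
  refine key.trans ?_
  calc 136 * (2 / ((r : ℝ) - 2)) ^ 2 *
        ∑ i, (if (r : ℤ) ≤ edgeDist e i ∧ edgeDist e i ≤ 2 * (r : ℤ) then ((hodgeQ H)⁻¹ e i) ^ 2 else 0)
      ≤ 136 * (36 / (r : ℝ) ^ 2) * ∑ e' ∈ (Finset.univ : Finset (LandauFree H)).filter
          (fun e' => (r : ℤ) ≤ ∑ m : Fin 4, |e.1.1.1 m - e'.1.1.1 m| ∧ ∑ m : Fin 4, |e.1.1.1 m - e'.1.1.1 m| < 2 * r + 4),
          ((hodgeQ H)⁻¹ e e') ^ 2 :=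
        mul_le_mul (mul_le_mul_of_nonneg_left hκ (by norm_num)) hzone hT0
          (mul_nonneg (by norm_num) (div_nonneg (by norm_num) (sq_nonneg _)))
    _ = 4896 / (r : ℝ) ^ 2 * _ := by ring

/-! ## §11 energy decay from S3 alone -/

/-- **`GradKernelEnergyDecay ⇐ S3`**: with the Caccioppoli inequality proved for `r ≥ 3`, the §11 energy decay of the gradient-kernel row follows
from the registered stub S3 (`LandauKernelDecay ∧ LandauVarianceBounded`) alone; `j ≤ 5` is absorbed into the near part. -/
theorem gradKernelEnergyDecay_of_S3 (hDec : LandauKernelDecay) (hVar : LandauVarianceBounded) : GradKernelEnergyDecay := by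
  obtain ⟨C₂, hC₂⟩ := hDec
  obtain ⟨C₃, hC₃⟩ := hVar
  refine ⟨36 * max C₃ 0 + 16 * (4 * 14641 * 256) * 4896 * (max C₂ 0) ^ 2, fun H hH e j => ?_⟩
  have hC₂'0 : 0 ≤ max C₂ 0 := le_max_right _ _
  have hC₃'0 : 0 ≤ max C₃ 0 := le_max_right _ _
  have hH1 : (1 : ℝ) ≤ H := by exact_mod_cast hH
  have hL1 : 1 ≤ 1 + Real.log (H : ℝ) := by have := Real.log_nonneg hH1; linarith
  have hj0 : (0 : ℝ) < (1 + (j : ℝ)) ^ 2 := by positivity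
  have hsum0 : 0 ≤ ∑ p ∈ (hodgePlaqs H).filter (fun p => (j : ℤ) ≤ edgePlaqDist e p),
      (((hodgeQ H)⁻¹ *ᵥ landauCoeff H p) e) ^ 2 := Finset.sum_nonneg fun _ _ => sq_nonneg _
  -- the near part: the whole row is bounded by the variance (S3a)
  have hnear : ∑ p ∈ (hodgePlaqs H).filter (fun p => (j : ℤ) ≤ edgePlaqDist e p),
      (((hodgeQ H)⁻¹ *ᵥ landauCoeff H p) e) ^ 2 ≤ max C₃ 0 :=
    calc ∑ p ∈ (hodgePlaqs H).filter (fun p => (j : ℤ) ≤ edgePlaqDist e p), (((hodgeQ H)⁻¹ *ᵥ landauCoeff H p) e) ^ 2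
        ≤ ∑ p ∈ hodgePlaqs H, (((hodgeQ H)⁻¹ *ᵥ landauCoeff H p) e) ^ 2 :=
          Finset.sum_le_sum_of_subset_of_nonneg (Finset.filter_subset _ _) fun _ _ _ => sq_nonneg _
      _ ≤ (hodgeQ H)⁻¹ e e := sum_sq_gradKernel_le_diag H e
      _ ≤ max C₃ 0 := (hC₃ H hH e).trans (le_max_left _ _)
  rw [le_div_iff₀ hj0]
  by_cases hj : j ≤ 5
  · -- near: `(1+j)² ≤ 36`, `L² ≥ 1`
    have h36 : (1 + (j : ℝ)) ^ 2 ≤ 36 := by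
      have : (j : ℝ) ≤ 5 := by exact_mod_cast hj
      nlinarith
    have hL2 : 1 ≤ (1 + Real.log (H : ℝ)) ^ 2 := one_le_pow₀ hL1
    have hfar0 : 0 ≤ 16 * (4 * 14641 * 256) * 4896 * (max C₂ 0) ^ 2 * (1 + Real.log (H : ℝ)) ^ 2 := by positivity
    nlinarith
  · -- far: `r = ⌊j/2⌋ ≥ 3`; the proved Caccioppoli inequality + the annulus energy from S3b
    push Not at hj
    obtain ⟨r, hr⟩ : ∃ r : ℕ, r = j / 2 := ⟨_, rfl⟩
    have hr3 : 3 ≤ r := by omega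
    have hr1 : 1 ≤ r := by omega
    have h2r : 2 * r ≤ j := by omega
    have hjr : j ≤ 2 * r + 1 := by omega
    have hr0 : (0 : ℝ) < r := by exact_mod_cast (show 0 < r by omega)
    have hK : ∀ e' : LandauFree H, |(hodgeQ H)⁻¹ e e'| ≤
        max C₂ 0 * (1 + Real.log (H : ℝ)) / (1 + ⨆ k : Fin 4, |((e.1.1.1 k - e'.1.1.1 k : ℤ) : ℝ)|) ^ 2 := fun e' =>
      (hC₂ H hH e e').trans
        (div_le_div_of_nonneg_right (mul_le_mul_of_nonneg_right (le_max_left _ _) (by linarith)) (by positivity))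
    have hAle := annulus_sum_sq_le e (B := max C₂ 0 * (1 + Real.log (H : ℝ))) (by positivity) hK hr1
    have hsub2 : (hodgePlaqs H).filter (fun p => (j : ℤ) ≤ edgePlaqDist e p) ⊆
        (hodgePlaqs H).filter (fun p => 2 * (r : ℤ) ≤ edgePlaqDist e p) := by
      intro p hp
      rw [Finset.mem_filter] at hp ⊢
      refine ⟨hp.1, ?_⟩
      have : (2 * r : ℤ) ≤ j := by exact_mod_cast h2r
      linarith [hp.2]
    have hfar := (Finset.sum_le_sum_of_subset_of_nonneg hsub2 (f := fun p => (((hodgeQ H)⁻¹ *ᵥ landauCoeff H p) e) ^ 2)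
      fun _ _ _ => sq_nonneg _).trans (hodgeCaccioppoli_three e hr3)
    have hrj : (1 + (j : ℝ)) ^ 2 ≤ 16 * (r : ℝ) ^ 2 := by
      have : (j : ℝ) ≤ 2 * r + 1 := by exact_mod_cast hjr
      have hr1' : (1 : ℝ) ≤ r := by exact_mod_cast hr1
      nlinarith
    -- abstract bookkeeping
    have key : ∀ X A L : ℝ, 0 ≤ X → 0 ≤ A → 1 ≤ L → X ≤ 4896 / (r : ℝ) ^ 2 * A →
        A ≤ 4 * 14641 * 256 * (max C₂ 0 * L) ^ 2 →
        X * (1 + (j : ℝ)) ^ 2 ≤ (36 * max C₃ 0 + 16 * (4 * 14641 * 256) * 4896 * (max C₂ 0) ^ 2) * L ^ 2 := by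
      intro X A L hX0 hA0 hL1' hXA hAB
      have hnear0 : 0 ≤ 36 * max C₃ 0 * L ^ 2 := by positivity
      calc X * (1 + (j : ℝ)) ^ 2 ≤ (4896 / (r : ℝ) ^ 2 * A) * (16 * (r : ℝ) ^ 2) :=
            mul_le_mul hXA hrj hj0.le (by positivity)
        _ = 16 * 4896 * A := by field_simp
        _ ≤ 16 * 4896 * (4 * 14641 * 256 * (max C₂ 0 * L) ^ 2) := mul_le_mul_of_nonneg_left hAB (by positivity)
        _ ≤ (36 * max C₃ 0 + 16 * (4 * 14641 * 256) * 4896 * (max C₂ 0) ^ 2) * L ^ 2 := by nlinarith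
    exact key _ _ _ hsum0 (Finset.sum_nonneg fun _ _ => sq_nonneg _) hL1 hfar hAle

/-- **Corollary**: the ℓ¹ row bound H4b.1 (one log) of the S4b bootstrap follows from S3 alone
(`h4b1one_of_energyDecay ∘ gradKernelEnergyDecay_of_S3`). -/
theorem h4b1one_of_S3 (hDec : LandauKernelDecay) (hVar : LandauVarianceBounded) : H4b1one :=
  h4b1one_of_energyDecay (gradKernelEnergyDecay_of_S3 hDec hVar)

end Summit.QuantumFields.YangMills.Theorems.AllWindowsColdBoxBoxHighLine

end
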